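import Summits.HodgeConjecture.CorCM.Census.CoinvariantFloor

/-!
# The coinvariant fibre `φ₂(G, c)`, V: the type sum mod `2`, `hodge2 = ts2⁻¹(𝔽₂·𝟙)`, `ker par2 = I_G·𝔽₂[types]`, and the interval
# type of a generator

COR-CM (cell `pub-hodgecm2`), count-neutral kernel combinatorics by the binder seat b09 (gen 29; lane COINVARIANT-FLOOR),
part V, sequel of `Census/CoinvariantFloor.lean` (II); the toolkit for part VI (`Census/CoinvariantCyclic.lean`: for CYCLIC `G`,
`φ₂ = β − 1` exactly).  Theorems + two bookkeeping definitions (`ts2`, the type sum mod `2`; `ivl`, the interval type of a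
generator); no `decide` beyond numerals of `ZMod 2`, no certificate, no named fact, no `sorry`.  HONEST FRAMING: `HC_CM` is NOT
proved; nothing here is a period or a headline.

CONTENT (`G` finite, `c` an involution, central / `≠ 1` where stated).
* §1 **The type sum mod `2`** `ts2 : 𝔽₂[types] → 𝔽₂^G`, `[Ψ] ↦ 1_Ψ`: `ts2 ∘ red = typeSum mod 2` (`ts2_red`), `G`-equivariance
  `ts2 (x·Q⁻¹)(P) = ts2 x (PQ)` (`ts2_mapDomain_rt`), the pair identity `typeSum y (x) + typeSum y (cx) = Σ_Ψ y(Ψ)`, and the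
  **SURJECTIVITY of the integral type sum onto `{f | f(x) + f(cx) = const}`** (`exists_typeSum_eq`:
  `f = Σ_{t ∈ T₀} f(t)(1_{T₀} − 1_{T₀^{(t)}}) + k·1_{T̄₀}`).
* §2 **`hodge2 = ts2⁻¹(𝔽₂·𝟙)`** (`mem_hodge2_iff`): the easy half reduces `mem_hodgeSpan_iff` of part I; the hard half lifts to `ℤ`,
  corrects the lift by `2w` using §1's surjectivity so that the type sum becomes constant, and applies `gfaces_generate`.
* §3 **`ker par2` is the augmentation submodule** `I_G·𝔽₂[types] = 𝔽₂⟨y·Q⁻¹ − y⟩` (zero block sums; every `G`: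
  `mem_span_cobdryAll_of_par2_eq_zero`), and for `G = ⟨g⟩` it is `(·g⁻¹ − 1)·𝔽₂[types]` (telescope `Q = g^k`:
  `exists_sub_eq_of_par2_eq_zero`).
* §4 **The interval type** `Ψ₀ = ivl = {1, g, …, g^{m−1}}` of a generator `g` of a cyclic group of order `2m` (`c = g^m`,
  `eq_pow_half_of_generator`) and the TELESCOPING of its half block-sum: `s₀ = Σ_{k<m} [Ψ₀·g^{−k}]` has `s₀·g⁻¹ − s₀ = [Ψ₀] + [Ψ̄₀]`,
  ONE pair (`exists_sub_eq_red_pair`).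

## References
* [Pohlmann1968] H. Pohlmann, Algebraic cycles on abelian varieties of complex multiplication type, Ann. of Math. 88 (1968), Thm 1.
-/

namespace Summit.HodgeConjecture.CorCM.Census.Coinvariant

open Finset
open Summit.HodgeConjecture.CorCM.Prior.AllgGroup.RfwfAllgGroup
open Summit.HodgeConjecture.CorCM.Census.BlockParity

noncomputable section

variable {G : Type*} [Group G] [Fintype G] [DecidableEq G] (c : G)

/-! ## §1 The type sum mod `2` and the surjectivity of the integral type sum -/

/-- **The type sum mod `2`** `ts2 : 𝔽₂[types] → 𝔽₂^G`, `[Ψ] ↦ 1_Ψ`. [folklore] -/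
def ts2 : (CMF G c →₀ ZMod 2) →ₗ[ZMod 2] (G → ZMod 2) :=
  Finsupp.linearCombination (ZMod 2) fun Ψ x => if x ∈ Ψ.1 then 1 else 0

/-- `ts2 [Ψ]·a = a · 1_Ψ`. [folklore] -/
theorem ts2_single (Ψ : CMF G c) (a : ZMod 2) (x : G) : ts2 c (Finsupp.single Ψ a) x = if x ∈ Ψ.1 then a else 0 := by
  simp only [ts2, Finsupp.linearCombination_single, Pi.smul_apply, smul_eq_mul, mul_ite, mul_one, mul_zero]

/-- **`ts2 ∘ red = typeSum mod 2`.** [folklore] -/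
theorem ts2_red (y : CMF G c →₀ ℤ) (x : G) : ts2 c (red c y) x = ((typeSum G c y x : ℤ) : ZMod 2) := by
  induction y using Finsupp.induction_linear with
  | zero => simp
  | add f g hf hg => rw [map_add, map_add, Pi.add_apply, hf, hg, map_add, Pi.add_apply, Int.cast_add]
  | single Ψ n =>
    rw [red_single, ts2_single, ← Finsupp.smul_single_one, map_smul, typeSum_single, Pi.smul_apply, smul_eq_mul]
    unfold indG
    split_ifs <;> simp

/-- **Equivariance**: `ts2 (x·Q⁻¹) (P) = ts2 x (P·Q)`. [folklore] -/
theorem ts2_mapDomain_rt (Q : G) (x : CMF G c →₀ ZMod 2) (P : G) :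
    ts2 c (Finsupp.mapDomain (rt c Q) x) P = ts2 c x (P * Q) := by
  induction x using Finsupp.induction_linear with
  | zero => simp
  | add f g hf hg => rw [Finsupp.mapDomain_add, map_add, map_add, Pi.add_apply, Pi.add_apply, hf, hg]
  | single Ψ a => simp only [Finsupp.mapDomain_single, ts2_single, mem_rt]

/-- The pair identity for type sums: `typeSum y (x) + typeSum y (cx) = Σ_Ψ y(Ψ)` (every type contains exactly one of `x, cx`).
[folklore] -/
theorem typeSum_add_typeSum_cmul (y : CMF G c →₀ ℤ) (x : G) :
    typeSum G c y x + typeSum G c y (c * x) = y.sum fun _ n => n := by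
  induction y using Finsupp.induction_linear with
  | zero => simp
  | add f g hf hg =>
    rw [map_add, Pi.add_apply, Pi.add_apply, Finsupp.sum_add_index' (fun _ => rfl) (fun _ _ _ => rfl), ← hf, ← hg]
    ring
  | single Ψ n =>
    rw [← Finsupp.smul_single_one, map_smul, Pi.smul_apply, Pi.smul_apply, typeSum_single, smul_eq_mul, smul_eq_mul,
      ← mul_add, indG_pair, mul_one, Finsupp.smul_single_one, Finsupp.sum_single_index rfl]

/-- **Surjectivity of the integral type sum onto `{f | f(x) + f(cx) = const}`**: every such `f` is a type sum — `f = Σ_{t ∈ T₀} f(t)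
(1_{T₀} − 1_{T₀^{(t)}}) + k·1_{T̄₀}` for a base type `T₀`. [folklore] -/
theorem exists_typeSum_eq (hc2 : c * c = 1) (hc1 : c ≠ 1) (hcen : ∀ x : G, x * c = c * x) {f : G → ℤ} {k : ℤ}
    (hf : ∀ x, f x + f (c * x) = k) : ∃ w : CMF G c →₀ ℤ, typeSum G c w = f := by
  obtain ⟨T, hT⟩ := exists_isCMF c hc2 hc1
  let T₀ : CMF G c := ⟨T, hT⟩
  refine ⟨∑ t ∈ T, f t • (Finsupp.single T₀ 1 - Finsupp.single (oflipCM c hc2 t T₀) 1) + k • Finsupp.single (rt c c T₀) 1, ?_⟩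
  have hflip : ∀ t ∈ T, ∀ x, indG T x - indG (oflip c t T) x = (if x = t then 1 else 0) - (if x = c * t then 1 else 0) := by
    intro t ht x
    have hct : c * t ∉ T := (hT t).mp ht
    by_cases hx : x ∈ orb c t
    · rw [indG_oflip_of_mem c hx]
      rcases (mem_orb c).mp hx with rfl | rfl
      · have h1 : x ≠ c * x := fun h => hc1 (mul_right_cancel (h.symm.trans (one_mul x).symm))
        simp [indG, ht, h1]
      · have h1 : c * t ≠ t := fun h => hc1 (mul_right_cancel (h.trans (one_mul t).symm))
        simp [indG, hct, h1]
    · rw [indG_oflip_of_not_mem c hx, sub_self]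
      have h1 : x ≠ t := fun h => hx ((mem_orb c).mpr (Or.inl h))
      have h2 : x ≠ c * t := fun h => hx ((mem_orb c).mpr (Or.inr h))
      simp [h1, h2]
  have hbar : ∀ x, indG (rt c c T₀).1 x = indG T (c * x) := by
    intro x
    unfold indG
    rw [← hcen x]
    by_cases h : x * c ∈ T
    · rw [if_pos ((mem_rt c c T₀ x).mpr h), if_pos h]
    · rw [if_neg (fun h' => h ((mem_rt c c T₀ x).mp h')), if_neg h]
  funext x
  rw [map_add, map_sum, map_smul, Pi.add_apply, Finset.sum_apply, Pi.smul_apply, typeSum_single, smul_eq_mul, hbar]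
  simp only [map_smul, map_sub, typeSum_single, Pi.smul_apply, Pi.sub_apply, smul_eq_mul]
  have hrw : ∑ t ∈ T, f t * (indG T x - indG (oflipCM c hc2 t T₀).1 x) =
      ∑ t ∈ T, f t * ((if x = t then 1 else 0) - (if x = c * t then 1 else 0)) :=
    Finset.sum_congr rfl fun t ht => by rw [show (oflipCM c hc2 t T₀).1 = oflip c t T from rfl, hflip t ht x]
  rw [hrw]
  simp only [mul_sub, Finset.sum_sub_distrib, mul_ite, mul_one, mul_zero]
  by_cases hxT : x ∈ T
  · have hcx : c * x ∉ T := (hT x).mp hxT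
    have h2 : ∀ t ∈ T, x ≠ c * t := fun t ht h => by
      apply hcx; rw [h, ← mul_assoc, hc2, one_mul]; exact ht
    rw [Finset.sum_ite_eq T x, if_pos hxT, Finset.sum_eq_zero (fun t ht => if_neg (h2 t ht))]
    simp [indG, hcx]
  · have hcx : c * x ∈ T := by by_contra h; exact hxT ((hT x).mpr h)
    have h1 : ∀ t ∈ T, x ≠ t := fun t ht h => hxT (h ▸ ht)
    rw [Finset.sum_eq_zero (fun t ht => if_neg (h1 t ht))]
    have h3 : ∑ t ∈ T, (if x = c * t then f t else 0) = f (c * x) := by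
      rw [Finset.sum_eq_single (c * x)]
      · rw [if_pos (by rw [← mul_assoc, hc2, one_mul])]
      · intro t _ hne
        rw [if_neg]
        intro h; apply hne; rw [h, ← mul_assoc, hc2, one_mul]
      · intro h; exact absurd hcx h
    rw [h3]
    simp only [indG, if_pos hcx]
    have := hf x
    linarith

/-! ## §2 The Hodge lattice mod `2` is `ts2⁻¹(𝔽₂·𝟙)` -/

/-- Every element of `hodge2` is the reduction of an integer Hodge vector. [folklore] -/
theorem exists_red_eq_of_mem_hodge2 (hc2 : c * c = 1) {z : CMF G c →₀ ZMod 2} (hz : z ∈ hodge2 c hc2) :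
    ∃ y ∈ hodgeSpan c hc2, red c y = z := by
  have key : ∀ (X : Set (CMF G c →₀ ℤ)) (z : CMF G c →₀ ZMod 2), z ∈ Submodule.span (ZMod 2) (red c '' X) →
      ∃ y ∈ Submodule.span ℤ X, red c y = z := by
    intro X z hz
    induction hz using Submodule.span_induction with
    | mem _ h =>
      obtain ⟨y, hy, rfl⟩ := h
      exact ⟨y, Submodule.subset_span hy, rfl⟩
    | zero => exact ⟨0, Submodule.zero_mem _, map_zero _⟩
    | add _ _ _ _ h1 h2 =>
      obtain ⟨y1, hy1, rfl⟩ := h1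
      obtain ⟨y2, hy2, rfl⟩ := h2
      exact ⟨y1 + y2, Submodule.add_mem _ hy1 hy2, map_add _ _ _⟩
    | smul a _ _ h =>
      obtain ⟨y, hy, rfl⟩ := h
      refine ⟨(a.val : ℤ) • y, Submodule.smul_mem _ _ hy, ?_⟩
      rw [map_zsmul, ← Int.cast_smul_eq_zsmul (ZMod 2), Int.cast_natCast, ZMod.natCast_zmod_val]
  obtain ⟨f, hf, q, hq, rfl⟩ := Submodule.mem_sup.mp hz
  obtain ⟨y1, hy1, rfl⟩ := key _ f hf
  obtain ⟨y2, hy2, rfl⟩ := key _ q hq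
  exact ⟨y1 + y2, Submodule.add_mem _ (Submodule.mem_sup_left hy1) (Submodule.mem_sup_right hy2), map_add _ _ _⟩

/-- **Easy half**: Hodge vectors mod `2` have constant type sum mod `2`. [folklore] -/
theorem exists_forall_ts2_eq_of_mem_hodge2 (hc2 : c * c = 1) (hcen : ∀ x : G, x * c = c * x) {z : CMF G c →₀ ZMod 2}
    (hz : z ∈ hodge2 c hc2) : ∃ a : ZMod 2, ∀ x, ts2 c z x = a := by
  obtain ⟨y, hy, rfl⟩ := exists_red_eq_of_mem_hodge2 c hc2 hz
  obtain ⟨k, hk⟩ := exists_forall_typeSum_eq_of_mem_hodgeSpan c hc2 hcen hy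
  exact ⟨(k : ZMod 2), fun x => by rw [ts2_red, hk]⟩

/-- **Hard half**: a vector with constant type sum mod `2` is a Hodge vector mod `2` (lift to `ℤ`, correct by `2·w` using the
surjectivity `exists_typeSum_eq`, then `gfaces_generate`). [folklore] -/
theorem mem_hodge2_of_forall_ts2_eq (hc2 : c * c = 1) (hc1 : c ≠ 1) (hcen : ∀ x : G, x * c = c * x)
    {z : CMF G c →₀ ZMod 2} {a : ZMod 2} (hz : ∀ x, ts2 c z x = a) : z ∈ hodge2 c hc2 := by
  -- integer lift
  set y : CMF G c →₀ ℤ := Finsupp.mapRange (fun b : ZMod 2 => (b.val : ℤ)) (by simp) z with hy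
  have hred : red c y = z := by
    ext Ψ
    rw [red_apply, Finsupp.mapRange_apply, hy, Finsupp.mapRange_apply, Int.cast_natCast, ZMod.natCast_zmod_val]
  -- `typeSum y = ã + 2 e` with `e(x) + e(cx)` constant
  have hmod : ∀ x, ((typeSum G c y x : ℤ) : ZMod 2) = (a.val : ℤ) := by
    intro x; rw [← ts2_red, hred, hz, Int.cast_natCast, ZMod.natCast_zmod_val]
  have hdvd : ∀ x, (2 : ℤ) ∣ typeSum G c y x - a.val := fun x =>
    (ZMod.intCast_zmod_eq_zero_iff_dvd _ 2).mp (by rw [Int.cast_sub, hmod, sub_self])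
  choose e he using hdvd
  obtain ⟨K, hK⟩ : ∃ K : ℤ, ∀ x, typeSum G c y x + typeSum G c y (c * x) = K :=
    ⟨y.sum fun _ n => n, typeSum_add_typeSum_cmul c y⟩
  have he2 : ∀ x, e x + e (c * x) = (K - 2 * a.val) / 2 := by
    intro x
    have h1 := he x
    have h2 := he (c * x)
    have h3 := hK x
    have h4 : (2 : ℤ) * (e x + e (c * x)) = K - 2 * a.val := by linarith
    omega
  obtain ⟨w, hw⟩ := exists_typeSum_eq c hc2 hc1 hcen he2
  -- `y − 2w` is an integer Hodge vector reducing to `z`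
  have hyw : y - (2 : ℤ) • w ∈ hodgeSpan c hc2 := by
    refine mem_hodgeSpan_of_forall_typeSum_eq c hc2 hc1 hcen (k := a.val) fun x => ?_
    rw [map_sub, map_smul, Pi.sub_apply, Pi.smul_apply, hw, smul_eq_mul]
    have := he x
    linarith
  have hred2 : red c (y - (2 : ℤ) • w) = z := by
    rw [map_sub, map_zsmul, hred]
    have h2 : (2 : ℤ) • red c w = 0 := by
      ext Ψ
      rw [Finsupp.smul_apply, Finsupp.zero_apply, ← Int.cast_smul_eq_zsmul (ZMod 2),
        show ((2 : ℤ) : ZMod 2) = 0 by decide, zero_smul]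
    rw [h2, sub_zero]
  rw [← hred2]
  exact red_mem_hodge2 c hc2 hyw

/-- **`hodge2 = ts2⁻¹(𝔽₂·𝟙)`** (central `c ≠ 1`). [folklore] -/
theorem mem_hodge2_iff (hc2 : c * c = 1) (hc1 : c ≠ 1) (hcen : ∀ x : G, x * c = c * x) (z : CMF G c →₀ ZMod 2) :
    z ∈ hodge2 c hc2 ↔ ∃ a : ZMod 2, ∀ x, ts2 c z x = a :=
  ⟨exists_forall_ts2_eq_of_mem_hodge2 c hc2 hcen, fun ⟨_, h⟩ => mem_hodge2_of_forall_ts2_eq c hc2 hc1 hcen h⟩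

/-! ## §3 `ker par2` is the augmentation submodule (zero block sums) -/

/-- The augmentation submodule `I_G · 𝔽₂[types] = 𝔽₂⟨y·Q⁻¹ − y⟩`. [folklore] -/
theorem mem_span_cobdryAll_of_par2_eq_zero {x : CMF G c →₀ ZMod 2} (hx : par2 c x = 0) :
    x ∈ Submodule.span (ZMod 2) {y : CMF G c →₀ ZMod 2 | ∃ (Q : G) (z : CMF G c →₀ ZMod 2), y = Finsupp.mapDomain (rt c Q) z - z} := by
  classical
  set A := Submodule.span (ZMod 2)
    {y : CMF G c →₀ ZMod 2 | ∃ (Q : G) (z : CMF G c →₀ ZMod 2), y = Finsupp.mapDomain (rt c Q) z - z} with hA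
  -- representatives of blocks
  obtain ⟨rep, hrep⟩ : ∃ rep : Block c → CMF G c, ∀ B, blk c (rep B) = B :=
    ⟨Function.surjInv (blk_surjective c), Function.surjInv_eq (blk_surjective c)⟩
  -- `[Ψ] ≡ [rep (blk Ψ)]` modulo the augmentation submodule
  have hsingle : ∀ (Ψ : CMF G c) (a : ZMod 2), Finsupp.single Ψ a - Finsupp.single (rep (blk c Ψ)) a ∈ A := by
    intro Ψ a
    obtain ⟨Q, hQ⟩ := exists_rt_eq_of_blk_eq c (hrep (blk c Ψ))
    refine Submodule.subset_span ⟨Q, Finsupp.single (rep (blk c Ψ)) a, ?_⟩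
    rw [Finsupp.mapDomain_single, hQ]
  -- the projection `x ↦ Σ_Ψ x(Ψ) [rep (blk Ψ)]` vanishes when all block sums vanish
  have hproj : ∑ Ψ, Finsupp.single (rep (blk c Ψ)) (x Ψ) = 0 := by
    rw [← Finset.sum_fiberwise_of_maps_to (g := blk c) (fun Ψ _ => Finset.mem_univ (blk c Ψ))]
    refine Finset.sum_eq_zero fun B _ => ?_
    have hB : ∑ Ψ ∈ Finset.univ.filter (fun Ψ => blk c Ψ = B), Finsupp.single (rep (blk c Ψ)) (x Ψ) =
        Finsupp.single (rep B) (∑ Ψ ∈ Finset.univ.filter (fun Ψ => blk c Ψ = B), x Ψ) := by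
      rw [Finsupp.single_finsetSum]
      exact Finset.sum_congr rfl fun Ψ hΨ => by rw [(Finset.mem_filter.mp hΨ).2]
    have hsum : ∑ Ψ ∈ Finset.univ.filter (fun Ψ => blk c Ψ = B), x Ψ = par2 c x B := by
      conv_rhs => rw [← Finsupp.univ_sum_single x]
      rw [map_sum, Finset.sum_apply, Finset.sum_filter]
      refine Finset.sum_congr rfl fun Ψ _ => ?_
      rw [par2_single, Pi.smul_apply, Pi.single_apply, smul_eq_mul, mul_ite, mul_one, mul_zero]
      by_cases h : blk c Ψ = B
      · simp [h]
      · simp [h, Ne.symm h]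
    rw [hB, hsum, hx, Pi.zero_apply, Finsupp.single_zero]
  have hx' : x = ∑ Ψ, (Finsupp.single Ψ (x Ψ) - Finsupp.single (rep (blk c Ψ)) (x Ψ)) := by
    rw [Finset.sum_sub_distrib, hproj, sub_zero, Finsupp.univ_sum_single]
  rw [hx']
  exact Submodule.sum_mem _ fun Ψ _ => hsingle Ψ (x Ψ)

/-- For a generator `g` (`G = ⟨g⟩`), **the augmentation submodule is `(g − 1)·𝔽₂[types]`**: every `y·Q⁻¹ − y` is `(·g⁻¹ − 1) z`
(telescope `Q = g^k`). [folklore] -/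
theorem exists_sub_eq_of_par2_eq_zero {g : G} (hg : ∀ Q : G, Q ∈ Submonoid.powers g) {x : CMF G c →₀ ZMod 2}
    (hx : par2 c x = 0) : ∃ z : CMF G c →₀ ZMod 2, Finsupp.mapDomain (rt c g) z - z = x := by
  set D : (CMF G c →₀ ZMod 2) →ₗ[ZMod 2] (CMF G c →₀ ZMod 2) := Finsupp.lmapDomain (ZMod 2) (ZMod 2) (rt c g) - LinearMap.id
    with hD
  have hDap : ∀ z, D z = Finsupp.mapDomain (rt c g) z - z := fun z => rfl
  suffices h : x ∈ LinearMap.range D by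
    obtain ⟨z, hz⟩ := LinearMap.mem_range.mp h
    exact ⟨z, by rw [← hDap, hz]⟩
  have hle : Submodule.span (ZMod 2)
      {y : CMF G c →₀ ZMod 2 | ∃ (Q : G) (z : CMF G c →₀ ZMod 2), y = Finsupp.mapDomain (rt c Q) z - z} ≤ LinearMap.range D := by
    rw [Submodule.span_le]
    rintro _ ⟨Q, z, rfl⟩
    obtain ⟨k, rfl⟩ := (Submonoid.mem_powers_iff _ _).mp (hg Q)
    induction k with
    | zero => rw [pow_zero, mapDomain_rt_one, sub_self]; exact Submodule.zero_mem _
    | succ k ih =>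
      have e : Finsupp.mapDomain (rt c (g ^ (k + 1))) z - z =
          D (Finsupp.mapDomain (rt c (g ^ k)) z) + (Finsupp.mapDomain (rt c (g ^ k)) z - z) := by
        rw [hDap, ← mapDomain_rt_mul, pow_succ']; abel
      rw [SetLike.mem_coe, e]
      exact Submodule.add_mem _ (LinearMap.mem_range_self D _) ih
  exact hle (mem_span_cobdryAll_of_par2_eq_zero c hx)

/-! ## §4 The interval type of a generator and its telescoping half block-sum -/

omit [DecidableEq G] in
/-- In a cyclic group of even order generated by `g`, the involution is `g^{|G|/2}`. [folklore] -/
theorem eq_pow_half_of_generator (hc2 : c * c = 1) (hc1 : c ≠ 1) {g : G} (hg : ∀ Q : G, Q ∈ Submonoid.powers g) :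
    c = g ^ (Fintype.card G / 2) ∧ Fintype.card G = 2 * (Fintype.card G / 2) := by
  have ho : orderOf g = Fintype.card G := by
    rw [← Nat.card_eq_fintype_card]
    refine orderOf_eq_card_of_forall_mem_zpowers fun Q => ?_
    obtain ⟨k, rfl⟩ := (Submonoid.mem_powers_iff _ _).mp (hg Q)
    exact ⟨k, zpow_natCast g k⟩
  obtain ⟨j, hj⟩ := (Submonoid.mem_powers_iff _ _).mp (hg c)
  have h2j : Fintype.card G ∣ 2 * j := by
    rw [← ho, orderOf_dvd_iff_pow_eq_one, mul_comm, pow_mul, hj, pow_two, hc2]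
  have hnj : ¬ Fintype.card G ∣ j := by
    rw [← ho, orderOf_dvd_iff_pow_eq_one, hj]; exact hc1
  obtain ⟨q, hq⟩ := h2j
  have hqodd : Odd q := by
    rcases Nat.even_or_odd q with ⟨r, hr⟩ | hodd
    · exfalso; apply hnj; refine ⟨r, ?_⟩
      have : 2 * j = 2 * (Fintype.card G * r) := by rw [hq, hr]; ring
      omega
    · exact hodd
  have heven : Even (Fintype.card G) :=
    (Nat.even_mul.mp (hq ▸ even_two_mul j)).resolve_right (Nat.not_even_iff_odd.mpr hqodd)
  obtain ⟨r, hr⟩ := hqodd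
  obtain ⟨m, hm⟩ := heven
  have hm2 : Fintype.card G / 2 = m := by omega
  refine ⟨?_, by omega⟩
  rw [hm2, ← hj]
  have hjm : j = Fintype.card G * r + m := by
    have : 2 * j = 2 * (Fintype.card G * r + m) := by rw [hq, hr, hm]; ring
    omega
  rw [hjm, pow_add, pow_mul, ← ho, pow_orderOf_eq_one, one_pow, one_mul]

/-- **The interval type** `Ψ₀ = {1, g, …, g^{m−1}}` of a generator `g` of a cyclic group of order `2m` (a CM type for `c = g^m`).
[folklore] -/
def ivl (hc2 : c * c = 1) (hc1 : c ≠ 1) {g : G} (hg : ∀ Q : G, Q ∈ Submonoid.powers g) : CMF G c :=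
  ⟨(Finset.range (Fintype.card G / 2)).image fun i => g ^ i, by
    obtain ⟨hc, hcard⟩ := eq_pow_half_of_generator c hc2 hc1 hg
    set m := Fintype.card G / 2 with hm
    have ho : orderOf g = 2 * m := by
      rw [← hcard, ← Nat.card_eq_fintype_card]
      refine orderOf_eq_card_of_forall_mem_zpowers fun Q => ?_
      obtain ⟨k, rfl⟩ := (Submonoid.mem_powers_iff _ _).mp (hg Q)
      exact ⟨k, zpow_natCast g k⟩
    have hmem : ∀ k : ℕ, g ^ k ∈ (Finset.range m).image (fun i => g ^ i) ↔ k % (2 * m) < m := by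
      intro k
      rw [Finset.mem_image]
      constructor
      · rintro ⟨i, hi, he⟩
        rw [Finset.mem_range] at hi
        have := pow_eq_pow_iff_modEq.mp he
        rw [ho, Nat.ModEq, Nat.mod_eq_of_lt (by omega : i < 2 * m)] at this
        omega
      · intro hk
        refine ⟨k % (2 * m), Finset.mem_range.mpr hk, ?_⟩
        rw [pow_eq_pow_iff_modEq, ho, Nat.ModEq, Nat.mod_mod]
    intro x
    obtain ⟨k, rfl⟩ := (Submonoid.mem_powers_iff _ _).mp (hg x)
    rw [hc, ← pow_add, hmem, hmem]
    have h2m : 0 < 2 * m := by rw [← ho]; exact orderOf_pos g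
    have e1 : (m + k) % (2 * m) = (m + k % (2 * m)) % (2 * m) := by rw [Nat.add_mod, Nat.mod_eq_of_lt (by omega : m < 2 * m)]
    rw [e1]
    have hk2 : k % (2 * m) < 2 * m := Nat.mod_lt _ h2m
    constructor
    · intro hlt hge
      have : (m + k % (2 * m)) % (2 * m) = m + k % (2 * m) := Nat.mod_eq_of_lt (by omega)
      omega
    · intro hge
      push Not at hge
      by_contra hlt
      push Not at hlt
      have : (m + k % (2 * m)) % (2 * m) = m + k % (2 * m) - 2 * m := by
        rw [Nat.mod_eq_sub_mod (by omega), Nat.mod_eq_of_lt (by omega)]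
      omega⟩

omit [Fintype G] [DecidableEq G] in
/-- `−v = v` for `v ∈ 𝔽₂[X]`. [folklore] -/
theorem neg_eq_self_finsuppTwo {X : Type*} (v : X →₀ ZMod 2) : -v = v := by
  ext i; rw [Finsupp.neg_apply]; exact ZMod.neg_eq_self_mod_two _

/-- **Telescoping**: the half block-sum `s₀ = Σ_{k<m} [Ψ₀·g^{−k}]` of the interval type satisfies `s₀·g⁻¹ − s₀ = [Ψ₀] + [Ψ̄₀]`,
ONE pair. [folklore] -/
theorem exists_sub_eq_red_pair (hc2 : c * c = 1) (hc1 : c ≠ 1) {g : G} (hg : ∀ Q : G, Q ∈ Submonoid.powers g) :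
    ∃ s : CMF G c →₀ ZMod 2, Finsupp.mapDomain (rt c g) s - s = red c (pair c (ivl c hc2 hc1 hg)) := by
  obtain ⟨hc, _⟩ := eq_pow_half_of_generator c hc2 hc1 hg
  set m := Fintype.card G / 2
  set Ψ₀ := ivl c hc2 hc1 hg
  refine ⟨∑ k ∈ Finset.range m, Finsupp.single (rt c (g ^ k) Ψ₀) 1, ?_⟩
  rw [Finsupp.mapDomain_finsetSum]
  simp only [Finsupp.mapDomain_single]
  have e : ∀ k, rt c g (rt c (g ^ k) Ψ₀) = rt c (g ^ (k + 1)) Ψ₀ := fun k => by rw [← rt_mul, ← pow_succ']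
  simp only [e]
  rw [← Finset.sum_sub_distrib, Finset.sum_range_sub (fun k => Finsupp.single (rt c (g ^ k) Ψ₀) (1 : ZMod 2)), pow_zero,
    rt_one, ← hc, red_pair, sub_eq_add_neg, neg_eq_self_finsuppTwo, add_comm]

end

end Summit.HodgeConjecture.CorCM.Census.Coinvariant
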